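import Summits.Ventures.HSemireg.WedgeHankelRecurrenceCensusPolar
import Summits.Ventures.HSemireg.WedgeHankelRecurrenceCensusScheme

/-!
# Venture HSemireg — THE CENSUS BY APOLAR SCHEME WITH A NODE AT `∞`: for `m` monic of degree `d`, `e ≥ 1` and `2(d + e) ≤ N + 1`, **the classes `v` on `[0, N]` of middle rank `d + e`
# satisfying the recurrence `m` in window `d + e` (i.e. with affine denominator `m` and a node of exact order `e` at `∞`) are in bijection with `unitResidues m × polarParts e` via
# `(a, τ) ↦ dualSeq m a + τ`; hence there are `φ(m)·(s − 1)s^{e−1}` of them** (N53 is the case `e = 0`: `φ(m)`; N51 is the sum over the monic `m` of degree `d`)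

HONEST FRAMING. Part of the Lean index of the computation cell `pub-hsemireg` (seat p10 gen 29, Sunday typer «UNIFORM-IN-n»).
LINEAR ALGEBRA OF HANKEL (catalecticant) MATRICES and of polynomials over a field ONLY: no variety, no cohomology theory, no sheaf, no Ext group and no semiregularity map is constructed
here; nothing here says that HC / HC_CM / HC_AV holds; no Literature fact is declared or used.  Custodian versions as in `WedgeHankelSiegelIdeal` (1/3); the dictionary («apolar scheme
`{m = 0} + e·[∞]`») is QUOTED, never asserted.

WHAT IS IN THE TREE.  N34 (`WedgeHankelRecurrenceAffinePolar`, № 267): `rank_half_eq_and_mem_recSpace_iff_exists_affine_polar` (the structure theorem, both directions); N32 (№ 263) `dualSeq_unique`;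
N51 (`WedgeHankelRecurrenceCensusPolar`, № 340): `polarParts`, `ncard_polarParts`, `seqOf_dualSeq_add_apply`; N53 (`WedgeHankelRecurrenceCensusScheme`, № 371): `unitResidues`,
`ncard_unitResidues_of_irreducible`; N44 (№ 326) `seqOf`, `seqOf_apply_of_lt`; N34 `rank_hankel1_half_congr`; N23 `recSpace_congr`.  Mathlib: `Set.ncard_prod`, `Set.ncard_congr`.
THIS FILE (namespace `Summit.Ventures.HSemireg.Wedge.HankelOuter` continued; PLAIN on tree files; 0 definitions):
* §601 THE BIJECTION **`ncard_setOf_rank_eq_add_and_mem_recSpace`** (`= #unitResidues m · #polarParts e`), the count **`ncard_setOf_rank_eq_add_and_mem_recSpace'`** (`= φ(m)·(s − 1)s^{e−1}`),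
  `ncard_setOf_rank_eq_add_and_mem_recSpace_of_irreducible` (`m` irreducible of degree `d`: `(s^d − 1)(s − 1)s^{e−1}`).
Nothing Ext-side.  New names only.
-/

open Module Polynomial
open scoped Matrix Polynomial

namespace Summit.Ventures.HSemireg.Wedge.HankelOuter

open Summit.Ventures.HSemireg.Wedge Summit.Ventures.HSemireg.Wedge.Hankel

variable (K : Type*) [Field K] {N : ℕ}

/-! ## §601. The fibre of the apolar-scheme map over `(m, e)` -/

/-- **THE CLASSES OF RANK `deg m + e` SATISFYING `m` IN WINDOW `deg m + e` ARE THE PAIRS (UNIT RESIDUE mod `m`, POLAR PART OF ORDER `e`)**: for `m` monic, `1 ≤ e`, `2(deg m + e) ≤ N + 1`,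
`#{v | R^N(seqOf v) = deg m + e ∧ m ∈ Rec^N_{deg m + e}(seqOf v)} = #unitResidues m · #polarParts e` via `(a, τ) ↦ (i ↦ dualSeq m a i + τ i)` (N34 both ways; one-to-one by N32's uniqueness
on `[0, N − e]`, where the tails vanish, then cancellation). -/
theorem ncard_setOf_rank_eq_add_and_mem_recSpace {m : K[X]} (hm : m.Monic) {e : ℕ} (he : 1 ≤ e) (h2 : (m.natDegree + e) + (m.natDegree + e) ≤ N + 1) :
    {v : Fin (N + 1) → K | (hankel1 K N (N / 2) (seqOf K v)).rank = m.natDegree + e ∧ m ∈ recSpace K N (seqOf K v) (m.natDegree + e)}.ncard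
      = (unitResidues K m).ncard * (polarParts K N e).ncard := by
  rw [← Set.ncard_prod]
  symm
  refine Set.ncard_congr (fun p _ => fun i : Fin (N + 1) => dualSeq K m p.1 i + p.2 i) ?_ ?_ ?_
  · -- well-defined (N34, converse direction)
    rintro ⟨a, τ⟩ ⟨⟨ha, hcop⟩, hτ0, hτe⟩
    dsimp only at ha hcop hτ0 hτe ⊢
    have hagree : ∀ j ≤ N, seqOf K (fun i : Fin (N + 1) => dualSeq K m a i + τ i) j = (dualSeq K m a + seqOf K τ) j := fun j hj => by
      rw [Pi.add_apply, seqOf_dualSeq_add_apply K m a τ hj]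
    have key := (rank_half_eq_and_mem_recSpace_iff_exists_affine_polar K (N := N) hm he h2 (dualSeq K m a + seqOf K τ)).mpr ⟨a, seqOf K τ, hcop, ha, hτ0, hτe, fun j _ => rfl⟩
    rw [Set.mem_setOf_eq, rank_hankel1_half_congr K hagree, recSpace_congr K hagree]
    exact key
  · -- one-to-one
    rintro ⟨a, τ⟩ ⟨a', τ'⟩ ⟨⟨ha, -⟩, hτ0, -⟩ ⟨⟨ha', -⟩, hτ0', -⟩ h
    dsimp only at ha hτ0 ha' hτ0' h ⊢
    have hpt : ∀ i : Fin (N + 1), dualSeq K m a i + τ i = dualSeq K m a' i + τ' i := fun i => congrFun h i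
    have haa' : a = a' := dualSeq_unique K (N := N - e) hm (by omega) ha ha' fun j hj => by
      have h1 := hpt ⟨j, by omega⟩
      have hz : τ ⟨j, by omega⟩ = 0 := by have := hτ0 j (by omega); rwa [seqOf_apply_of_lt K τ (show j < N + 1 by omega)] at this
      have hz' : τ' ⟨j, by omega⟩ = 0 := by have := hτ0' j (by omega); rwa [seqOf_apply_of_lt K τ' (show j < N + 1 by omega)] at this
      rw [hz, hz', add_zero, add_zero] at h1
      exact h1
    subst haa'
    have hττ' : τ = τ' := funext fun i => add_left_cancel (hpt i)
    subst hττ'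
    rfl
  · -- onto (N34, direct direction)
    rintro v ⟨hq, hmem⟩
    obtain ⟨a, τ', hcop, ha, hτ0, hτe, hdec⟩ := (rank_half_eq_and_mem_recSpace_iff_exists_affine_polar K (N := N) hm he h2 (seqOf K v)).mp ⟨hq, hmem⟩
    have hτ' : ∀ j ≤ N, seqOf K (fun i : Fin (N + 1) => τ' i) j = τ' j := fun j hj => by rw [seqOf_apply_of_lt K _ (show j < N + 1 by omega)]
    refine ⟨(a, fun i => τ' i), Set.mk_mem_prod ⟨ha, hcop⟩ ⟨fun j hj => by rw [hτ' j (by omega)]; exact hτ0 j hj, by rw [hτ' _ (by omega)]; exact hτe⟩, funext fun i => ?_⟩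
    dsimp only
    rw [← seqOf_apply_of_lt K v i.2]
    exact (hdec i (by have := i.2; omega)).symm

/-- **over a field with `s` elements: `φ(m)·(s − 1)s^{e−1}` classes on `[0, N]` have rank `deg m + e` and satisfy the monic `m` in that window** (`1 ≤ e`, `2(deg m + e) ≤ N + 1`;
`φ(m) = #unitResidues m`). -/
theorem ncard_setOf_rank_eq_add_and_mem_recSpace' [Finite K] {m : K[X]} (hm : m.Monic) {e : ℕ} (he : 1 ≤ e) (h2 : (m.natDegree + e) + (m.natDegree + e) ≤ N + 1) :
    {v : Fin (N + 1) → K | (hankel1 K N (N / 2) (seqOf K v)).rank = m.natDegree + e ∧ m ∈ recSpace K N (seqOf K v) (m.natDegree + e)}.ncard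
      = (unitResidues K m).ncard * ((Nat.card K - 1) * Nat.card K ^ (e - 1)) := by
  rw [ncard_setOf_rank_eq_add_and_mem_recSpace K hm he h2, ncard_polarParts K he (by omega)]

/-- **`m` irreducible of degree `d`: `(s^d − 1)·(s − 1)s^{e−1}` classes of rank `d + e` satisfy `m`** (their apolar scheme is the closed point `{m = 0}` plus `e·[∞]`). -/
theorem ncard_setOf_rank_eq_add_and_mem_recSpace_of_irreducible [Finite K] {m : K[X]} (hm : m.Monic) (hirr : Irreducible m) {e : ℕ} (he : 1 ≤ e)
    (h2 : (m.natDegree + e) + (m.natDegree + e) ≤ N + 1) :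
    {v : Fin (N + 1) → K | (hankel1 K N (N / 2) (seqOf K v)).rank = m.natDegree + e ∧ m ∈ recSpace K N (seqOf K v) (m.natDegree + e)}.ncard
      = (Nat.card K ^ m.natDegree - 1) * ((Nat.card K - 1) * Nat.card K ^ (e - 1)) := by
  rw [ncard_setOf_rank_eq_add_and_mem_recSpace' K hm he h2, ncard_unitResidues_of_irreducible K hirr]

end Summit.Ventures.HSemireg.Wedge.HankelOuter
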